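import Summits.SmoothPoincare4.SmoothPoincare4.Theses.QuotientSpheres
import Literature.Topology.FourManifolds.RotationalQuotientFour
import HarnessLib.Audit

/-!
# Birth skeleton (BC3) — crux `CyclicShadows` (stmt-SmoothPoincare4-8189), route `QuotientSpheres`

`Cruxes/CyclicShadows/Lines/birth.lean` · registrar planner-skel-stmt-SmoothPoincare4-8189-0 ·
2026-08-17 · mode skeleton-register (route re-audit bin REPAIRABLE).  The crux is FIXED and is
concluded BY NAME:

  `Summit.SmoothPoincare4.SmoothPoincare4.Theses.QuotientSpheres.CyclicShadows`

= SHADOWS, the structural half of the route: every homotopy 4-sphere `Σ` is a CYCLIC BRANCHED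
QUOTIENT OF THE STANDARD `S⁴` of some order `n ≥ 2` — there are an order-`n` diffeomorphism `g`
of the round `S⁴` with a fixed point and a smooth fold map `q : S⁴ → Σ` whose fibres are the
`⟨g⟩`-orbits, a local diffeomorphism off `Fix g`, with the Hambleton–Hausmann branched chart
`(z, w) ↦ (z, wⁿ)` at the fixed points (the predicate is inlined in every item of the route; §0
names it `IsCyclicBranchedQuotient n g q`, `Iff.rfl`-verbatim).  Equivalently: `Σ` contains a
2-knot one of whose cyclic branched covers is `S⁴`.

## The cut — FINITE ORDER IN THE CONNECTED-SUM MONOID, then ROTATE THE SUMMANDS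

This is the layer-2 split foreseen in the route header (TWO-LAYER PLAN: "CyclicShadows ⇐
FiniteOrder → RotateSummands → CyclicShadows"; NOT DECOMPOSED YET (iv): "the glue FiniteOrder →
CyclicShadows … provable constructions (equivariant connected sum)").  In every dimension `d ≥ 5`
SHADOWS_d is a THEOREM for exactly this reason: `Θ_d` is finite (Kervaire–Milnor 1963, Thm. 1.2),
so `#ᵏΣ ≅ S^d` for `k = ord [Σ]`, and the `ℤ/k`-rotation of the `k` summands — the equivariant
connected sum `S^d #_ρ k·Σ` along a free orbit of the linear order-`k` rotation `ρ` of `S^d` — is a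
semifree `ℤ/k`-action on `#ᵏΣ ≅ S^d` with fixed set the linear `S^{d-2}` and orbit space
`(S^d/ρ) # Σ ≅ S^d # Σ ≅ Σ`.  In dimension 4 the two constructions survive verbatim and the ONLY
open input is finiteness of the order of `Σ`, which is the route's support item `FiniteOrder`
(stmt-SmoothPoincare4-8194) BY NAME.  Stubs:

* `stub_finiteOrder` (OPEN — the heart; BY NAME the route's support item `FiniteOrder`,
  stmt-8194): every homotopy 4-sphere `Σ` is diffeomorphic to `S⁴` or has `#ᵐ⁺²Σ ≅ S⁴` for some
  `m` (chain form `T₀ = Σ # Σ`, `Tᵢ₊₁ = Tᵢ # Σ`, `T_m ≅ S⁴`, typed with the tree's relational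
  `IsOrientedConnectedSum`).  The dimension-4 shape of Kervaire–Milnor finiteness; implied by
  `SmoothPoincare4` (left disjunct), STRONGER than the crux (this file), not known to follow from
  it (a shadow whose branch 2-knot is knotted in `Σ` does not exhibit `#ⁿΣ` as `S⁴`).  What the
  transfer exposes: the statement lives in the connected-sum monoid of homotopy 4-spheres, so every
  invariant additive under `#` and vanishing on `S⁴` must be torsion-valued or zero on all of it —
  a refuter's handle (an infinite-order `Σ` kills the stub and caps the line, not the crux) and a
  prover's handle (h-cobordism `Σ ∼ S⁴` is known, `Θ₄^{h-cob} = 0`, Kervaire–Milnor Thm. 1.1 +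
  Wall; the gap is exactly h-cobordism ⇒ finite order, cf. Wall's stable diffeomorphism
  `Σ # k(S²×S²) ≅ # k(S²×S²)`).
* `stub_roundShadow` (KNOWN; formal size M–L) — the ROUND case: if `Σ ≅ S⁴` then `Σ` is an
  order-2 shadow.  Content: the linear half-turn `ρ(x′, w) = (x′, −w)` of `S⁴ ⊂ ℝ³ ⊕ ℂ` with the
  fold map `q₀(x′, w) = (x′, w²)/‖(x′, w²)‖` exhibits the round `S⁴` as its own order-2 cyclic
  branched quotient — the `n = 2` instance of the route's support item `LinearQuotientModel`
  (stmt-8192; Hambleton–Hausmann 2010, Ex. 7.4 style) — and the predicate transports along a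
  diffeomorphism `θ : S⁴ ≅ Σ` (post-compose `q₀` with `θ`, push the quotient charts forward).
  Why it might fail: only as typed (the chart clause at the fixed sphere needs the radial
  correction `w ↦ w · ‖·‖^{-1/2}` of item 8192; a leak there is a leak in the route's predicate,
  which is what 8192 tests).
* `stub_rotateSummands` (KNOWN mathematics; formal size L–XL) — ROTATING THE SUMMANDS: if
  `T₀ = Σ # Σ`, `Tᵢ₊₁ = Tᵢ # Σ` (`i < m`) and `T_m ≅ S⁴`, then `Σ` is an order-`(m+2)` shadow.
  Construction: `ρ` = the linear rotation of order `k = m + 2` in the last two coordinates of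
  `ℝ⁵`, `Fix ρ = S² = {x₃ = x₄ = 0}`; choose a small round ball `B` about a free point with
  `B, ρB, …, ρ^{k-1}B` pairwise disjoint; the EQUIVARIANT CONNECTED SUM `N = S⁴ #_ρ k·Σ` (remove
  the `k` balls, glue in `k` punctured copies of `Σ` by `ρⁱ ∘ ι`) carries the order-`k`
  diffeomorphism `g` permuting the copies, free off `S²`, linear near `S²`; its orbit map
  `N → (S⁴ ∖ kB)/ρ ∪ Σ° = ((S⁴/ρ) ∖ ball) ∪ Σ° ≅ D⁴ ∪ Σ° ≅ Σ` is a cyclic branched quotient in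
  the sense of §0 (fold charts at `S²` from the linear model of stub 2's kind, covering charts
  elsewhere); `N ≅ #ᵏΣ ≅ T_m` (Kervaire–Milnor 1963 Lemma 2.1: `#` is well defined, associative
  and commutative on connected oriented manifolds, `S⁴ # X ≅ X`; tree `ConnectedSum*.lean`), so
  `N ≅ S⁴` by hypothesis, and conjugating `(g, q)` by `θ : S⁴ ≅ N` puts the data on the round
  `S⁴`.  Why it might fail: only as typed (orientation conventions of the chain: `ρ` preserves
  orientation, so all summands of `N` carry the same orientation, matching `T_m = #ᵐ⁺²Σ`; were the
  chain mixed, `T_m ≅ S⁴` unoriented would still give `N ≅ S⁴` or its mirror).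
  Sources: KervaireMilnorAnnals1963 §2, HambletonHausmann2010 App. §7 (Def. 7.1, Lemma 7.3,
  Ex. 7.4), Bredon1972 VI.2 (equivariant tubular neighbourhoods), Gordon1974 / Sumners1975 (the
  same rotate-the-summands device for knots).

`CyclicShadows_of : Sig.stub_finiteOrder → Sig.stub_roundShadow → Sig.stub_rotateSummands →
CyclicShadows` is PROVED (§3): for a homotopy 4-sphere `S`, finite order gives `S ≅ S⁴` (then the
round shadow, order 2) or a chain ending in `T_m ≅ S⁴` (then the rotated summands, order `m + 2`);
either way an `n ≥ 2` with `IsCyclicShadowOfOrder n S`, which is the crux's body for `S`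
(`cyclicShadows_iff`).  `lean check`: sorries ONLY in the three `stub_*`.

Hardest stub: `stub_finiteOrder` (open; no mechanism forcing finite order in dimension 4 is
known, and no invariant certifying infinite order either — the route's own "why it might fail"
for this crux).  The two known stubs are exactly the classical constructions that make SHADOWS a
theorem in dimensions ≥ 5; their failure could only be a typing failure of the inlined predicate,
which the route tests separately by `LinearQuotientModel` (stmt-8192).

BC3 probes (registrar, 2026-08-17, file `bc/probe_all.lean` of the registrar's folder): for each
of the three stub signatures `T`, `example : T → CyclicShadows` and `example : T → SmoothPoincare4`
by `first | exact? | simpa | aesop` FAIL (no stub is cheaply the crux or the summit; raw results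
in the registrar's NOTES.md and in the crux evidence note).

Disproof used: none exists for this crux (`ledger crux ls stmt-SmoothPoincare4-8189`: no
workfiles, no `Disproof.lean`, no `Theorems/CyclicShadows/Negative/*`, 2026-08-17); negatives
index of the summit: 0 refuted statements (2026-08-17).  The refuter's route-review stamp
(2026-08-15: predicate sanity — the chart clause forces `g` conjugate to a coprime rotation of
exact order `n` near `Fix`, `Fix` 2-dimensional, `g` orientation-preserving, free off `Fix`) and
the grounder's note (OPEN / NEW in dimension 4; dimension ≥ 5 by Kervaire–Milnor) are honoured:
the crux is used verbatim and concluded by name; no stub is an instance of a refuted statement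
(there are none).

Sources: KervaireMilnorAnnals1963 (Thm. 1.1, Thm. 1.2, §2 Lemma 2.1), HambletonHausmann2010 =
arXiv:0906.5057 (App. §7: Def. 7.1, Lemma 7.3, Ex. 7.4, Rem. 7.5; Prop. 5.3, Rem. 5.9),
Bredon1972 (VI.2), Gordon1974, Sumners1975, Pao1978, Plotnick1986, Wall1964 (stable
diffeomorphism of h-cobordant 4-manifolds).
-/

noncomputable section

-- every `Summit.SmoothPoincare4.SmoothPoincare4.…` name repeats the summit = sub-problem segment
-- (D-0017 layout); the duplicate is deliberate.
set_option linter.dupNamespace false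
set_option linter.unusedVariables false

namespace Summit.SmoothPoincare4.SmoothPoincare4.Cruxes.CyclicShadows.Birth

open scoped Manifold ContDiff Topology
open Set Function Literature.Topology.FourManifolds
open Summit.SmoothPoincare4.SmoothPoincare4.Theses.QuotientSpheres (CyclicShadows FiniteOrder
  InvolutionQuotient CyclicQuotient QuotientHomotopySphere LinearQuotientModel)

/-- Local notation: the round `4`-sphere `S⁴ ⊆ ℝ⁵` (Mathlib's analytic manifold, model `𝓡 4`),
the COVERING sphere of the crux (the symmetry lives upstairs, on the standard sphere). -/
local notation "𝕊⁴" => (Metric.sphere (0 : EuclideanSpace ℝ (Fin 5)) 1)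
/-- Local notation: the model space `ℝ⁴`. -/
local notation "𝔼⁴" => EuclideanSpace ℝ (Fin 4)

/-! ## §0 Vocabulary — the route's inlined predicate, named -/

/-- **`q : S⁴ → M` exhibits `M` as the order-`n` cyclic branched quotient of the round `S⁴` by
`g`** — TOKEN-IDENTICAL with the conjunction inlined in every item of route `QuotientSpheres`
(`InvolutionQuotient`, `CyclicShadows`, `CyclicQuotient`, `QuotientHomotopySphere`,
`LinearQuotientModel`): `g` is `C^∞` with `g^[n] = id`; `q` is `C^∞`, constant on `⟨g⟩`-orbits,
with fibres exactly the `⟨g⟩`-orbits, surjective, a local diffeomorphism at every non-fixed point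
of `g`; and at every fixed point `x` of `g` there are injective local-diffeomorphism charts `φ` on
an open `U ∋ x` of `S⁴` and `ψ` on an open `V ⊇ q(U)` of `M` in which `q` IS the
Hambleton–Hausmann fold `(z, w) ↦ (z, wⁿ)` (`ψ ∘ q = rotationFoldModel n ∘ φ` on `U`; the formula
is inlined exactly as in the route file, and is `Literature.Topology.FourManifolds.rotationFoldModel n`
of `RotationalQuotientFour.lean` by `rfl`, see the example below).  Hambleton–Hausmann 2010,
App. §7, Def. 7.1 / Lemma 7.3: `M` is then the orbit space `|S⁴/⟨g⟩|` with its canonical smooth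
structure. [HambletonHausmann2010, App. §7] -/
def IsCyclicBranchedQuotient (n : ℕ) (g : 𝕊⁴ → 𝕊⁴) {M : Type} [TopologicalSpace M]
    [ChartedSpace 𝔼⁴ M] (q : 𝕊⁴ → M) : Prop :=
  ContMDiff (𝓡 4) (𝓡 4) ∞ g ∧ g^[n] = id ∧ ContMDiff (𝓡 4) (𝓡 4) ∞ q ∧ (∀ x, q (g x) = q x) ∧
    (∀ x y, q x = q y → ∃ k : ℕ, y = g^[k] x) ∧ Function.Surjective q ∧
    (∀ x, g x ≠ x → IsLocalDiffeomorphAt (𝓡 4) (𝓡 4) ∞ q x) ∧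
    ∀ x, g x = x → ∃ (U : Set 𝕊⁴) (φ : 𝕊⁴ → 𝔼⁴) (V : Set M) (ψ : M → 𝔼⁴),
      IsOpen U ∧ x ∈ U ∧ Set.InjOn φ U ∧ (∀ y ∈ U, IsLocalDiffeomorphAt (𝓡 4) (𝓡 4) ∞ φ y) ∧
      IsOpen V ∧ q '' U ⊆ V ∧ Set.InjOn ψ V ∧ (∀ z ∈ V, IsLocalDiffeomorphAt (𝓡 4) (𝓡 4) ∞ ψ z) ∧
      ∀ y ∈ U, ψ (q y) = WithLp.toLp 2 (fun j : Fin 4 => if j = 2 then ((((φ y 2 : ℝ) : ℂ) +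
        ((φ y 3 : ℝ) : ℂ) * Complex.I) ^ n).re else if j = 3 then ((((φ y 2 : ℝ) : ℂ) +
        ((φ y 3 : ℝ) : ℂ) * Complex.I) ^ n).im else φ y j)

/-- **`S` is a cyclic shadow of order `n`**: the homotopy 4-sphere `S` is the order-`n` cyclic
branched quotient of the round `S⁴` by some `g` WITH A FIXED POINT (so `g` is semifree with fixed
set a possibly knotted `S²`, orientation-preserving, and `S.carrier = |S⁴/⟨g⟩|`) — the per-`Σ`,
per-`n` body of the crux (`cyclicShadows_iff`). [HambletonHausmann2010, App. §7] -/
def IsCyclicShadowOfOrder (n : ℕ) (S : HomotopySphere 4) : Prop :=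
  ∃ (g : 𝕊⁴ → 𝕊⁴) (q : 𝕊⁴ → S.carrier), (∃ x, g x = x) ∧ IsCyclicBranchedQuotient n g q

/-! ### Consistency with the route vocabulary (definitional) -/

/-- The inlined fold formula IS the Literature's `rotationFoldModel n` (`RotationalQuotientFour.lean`,
definition request D1 of this route), by `rfl`. -/
example (n : ℕ) (φ : 𝕊⁴ → 𝔼⁴) (y : 𝕊⁴) :
    rotationFoldModel n (φ y) = WithLp.toLp 2 (fun j : Fin 4 => if j = 2 then ((((φ y 2 : ℝ) : ℂ) +
        ((φ y 3 : ℝ) : ℂ) * Complex.I) ^ n).re else if j = 3 then ((((φ y 2 : ℝ) : ℂ) +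
        ((φ y 3 : ℝ) : ℂ) * Complex.I) ^ n).im else φ y j) :=
  rfl

/-- The crux, verbatim: `CyclicShadows ↔ ∀ S, ∃ n g q, 2 ≤ n ∧ (∃ x, g x = x) ∧
IsCyclicBranchedQuotient n g q` (`Iff.rfl`). -/
example : CyclicShadows ↔ ∀ S : HomotopySphere 4, ∃ (n : ℕ) (g : 𝕊⁴ → 𝕊⁴) (q : 𝕊⁴ → S.carrier),
    2 ≤ n ∧ (∃ x, g x = x) ∧ IsCyclicBranchedQuotient n g q :=
  Iff.rfl

/-- The rank-2 crux, verbatim: `InvolutionQuotient` is "every order-2 cyclic branched quotient of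
`S⁴` by a `g` with a fixed point is diffeomorphic to `S⁴`" (`Iff.rfl`). -/
example : InvolutionQuotient ↔ ∀ (g : 𝕊⁴ → 𝕊⁴) (M : Type) [TopologicalSpace M] [T2Space M]
    [SecondCountableTopology M] [ChartedSpace 𝔼⁴ M] [IsManifold (𝓡 4) ∞ M] (q : 𝕊⁴ → M),
    (∃ x, g x = x) → IsCyclicBranchedQuotient 2 g q → Nonempty (M ≃ₘ⟮𝓡 4, 𝓡 4⟯ 𝕊⁴) :=
  Iff.rfl

/-- The rank-4 crux, verbatim: `CyclicQuotient` is the same for every order `n ≥ 3` (`Iff.rfl`). -/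
example : CyclicQuotient ↔ ∀ n : ℕ, 3 ≤ n → ∀ (g : 𝕊⁴ → 𝕊⁴) (M : Type) [TopologicalSpace M]
    [T2Space M] [SecondCountableTopology M] [ChartedSpace 𝔼⁴ M] [IsManifold (𝓡 4) ∞ M]
    (q : 𝕊⁴ → M), (∃ x, g x = x) → IsCyclicBranchedQuotient n g q →
    Nonempty (M ≃ₘ⟮𝓡 4, 𝓡 4⟯ 𝕊⁴) :=
  Iff.rfl

/-- The crux unfolded one existential at a time: `Σ` is a shadow iff it is a cyclic shadow of
some order `n ≥ 2`. -/
theorem cyclicShadows_iff :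
    CyclicShadows ↔ ∀ S : HomotopySphere 4, ∃ n : ℕ, 2 ≤ n ∧ IsCyclicShadowOfOrder n S := by
  constructor
  · intro h S
    obtain ⟨n, g, q, hn, hfix, hdata⟩ := h S
    exact ⟨n, hn, g, q, hfix, hdata⟩
  · intro h S
    obtain ⟨n, hn, g, q, hfix, hdata⟩ := h S
    exact ⟨n, g, q, hn, hfix, hdata⟩

/-! ## §1 The stub SIGNATURES (`Sig.stub_<name>`; the skeleton audit reads the hypotheses of
`CyclicShadows_of` BY NAME, heads = stub names) -/

/-- **STUB 1 — FINITE ORDER** (OPEN — the heart) — BY NAME the route's support item `FiniteOrder`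
(stmt-SmoothPoincare4-8194): every homotopy 4-sphere `Σ` is diffeomorphic to `S⁴`, or some
`#ᵐ⁺²Σ` is: a chain `T₀ = Σ # Σ`, `Tᵢ₊₁ = Tᵢ # Σ` (`i < m`) of oriented connected sums
(`IsOrientedConnectedSum`, same orientation of `Σ` each time) with `T_m ≅ S⁴`.  The dimension-4
shape of Kervaire–Milnor finiteness of `Θₙ` (Ann. of Math. 77 (1963), Thm. 1.2); implied by
`SmoothPoincare4`; STRONGER than the crux (this file) and the only known mechanism producing
shadows.  Why it might fail: an exotic `Σ` of infinite order in the connected-sum monoid — nothing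
known forces finite order in dimension 4 (h-cobordism to `S⁴` IS known, `Θ₄^{h-cob} = 0`, and
Wall's theorem gives only STABLE triviality `Σ # k(S²×S²) ≅ # k(S²×S²)`), and no invariant
certifying infinite order exists either; its refutation caps this line without refuting the crux.
Sources: KervaireMilnorAnnals1963 (Thm. 1.1, 1.2), Wall1964, HambletonHausmann2010.
Size: open problem. -/
abbrev Sig.stub_finiteOrder : Prop :=
  FiniteOrder

/-- **STUB 2 — THE ROUND SPHERE IS AN ORDER-2 SHADOW OF ITSELF, TRANSPORTED** (known; formal size
M–L).  If `S.carrier ≅ S⁴` then `S` is a cyclic shadow of order 2: the linear half-turn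
`ρ(x′, w) = (x′, −w)` of `S⁴ ⊂ ℝ³ ⊕ ℂ` (fixed set the round `S² = {w = 0}`) with the fold map
`q₀(x′, w) = (x′, w²)/‖(x′, w²)‖` is an order-2 cyclic branched quotient `S⁴ → S⁴` in the sense of
`IsCyclicBranchedQuotient` — the `n = 2` instance of the route's support item `LinearQuotientModel`
(stmt-SmoothPoincare4-8192: `q₀` smooth since `‖(x′, w²)‖ ≠ 0` on `S⁴`; fibres `{x, ρx}`; local
diffeomorphism off `S²`; fold charts at `S²` after the radial correction `w ↦ w‖·‖^{-1/2}`,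
Hambleton–Hausmann 2010 Ex. 7.4 style) — and every clause transports along a diffeomorphism
`θ : S⁴ ≃ₘ S.carrier` (replace `q₀` by `θ ∘ q₀`, `V` by `θ(V)`, `ψ` by `ψ ∘ θ⁻¹`).
Why it might fail: only as typed — a failure is a leak in the route's inlined predicate, which is
exactly what item 8192 tests.  Sources: HambletonHausmann2010 (App. §7, Ex. 7.4),
stmt-SmoothPoincare4-8192. -/
def Sig.stub_roundShadow : Prop :=
  ∀ S : HomotopySphere 4, Nonempty (S.carrier ≃ₘ⟮𝓡 4, 𝓡 4⟯ 𝕊⁴) → IsCyclicShadowOfOrder 2 S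

/-- **STUB 3 — ROTATING THE SUMMANDS** (known mathematics; formal size L–XL).  If `T₀ = Σ # Σ`,
`Tᵢ₊₁ = Tᵢ # Σ` for `i < m`, and `T_m ≅ S⁴`, then `Σ` is a cyclic shadow of order `k = m + 2`.
Construction (the device that proves SHADOWS in dimensions ≥ 5, and Gordon's / Sumners'
rotate-the-summands construction of `ℤ/k`-symmetric knots): let `ρ` be the linear order-`k`
rotation in the last two coordinates of `ℝ⁵` (`Fix ρ = S²`), `B` a small round ball about a free
point with `ρⁱB` pairwise disjoint; the EQUIVARIANT CONNECTED SUM `N = S⁴ #_ρ k·Σ` (glue `k`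
punctured copies of `Σ` into the `ρⁱB` by `ρⁱ ∘ ι`) carries an order-`k` diffeomorphism `g`
(`ρ` on the sphere part, permuting the copies), free off `S²` and linear near it; its orbit map
`N → ((S⁴/ρ) ∖ ball) ∪ Σ° ≅ D⁴ ∪ Σ° ≅ Σ` satisfies `IsCyclicBranchedQuotient k` (fold charts at
`S²` as in stub 2, covering charts elsewhere; Hambleton–Hausmann Lemma 7.3, Bredon VI.2); and
`N ≅ #ᵏΣ ≅ T_m` because `#` is well defined, associative and commutative on connected oriented
closed manifolds and `S⁴ # X ≅ X` (Kervaire–Milnor 1963, Lemma 2.1; tree `ConnectedSum*.lean`),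
`ρ` being orientation-preserving so that all summands carry the same orientation as in the chain.
Hence `N ≅ S⁴`; conjugating `(g, q)` by `θ : S⁴ ≃ₘ N` gives the data on the round `S⁴`.
Why it might fail: only as typed (orientation bookkeeping of the chain; were it mixed, `T_m ≅ S⁴`
unoriented still gives `N ≅ S⁴` or its mirror `≅ S⁴`).  Sources: KervaireMilnorAnnals1963 §2,
HambletonHausmann2010 App. §7, Bredon1972 VI.2, Gordon1974, Sumners1975. -/
def Sig.stub_rotateSummands : Prop :=
  ∀ (S : HomotopySphere 4) (m : ℕ) (T : ℕ → HomotopySphere 4),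
    IsOrientedConnectedSum S.orientation S.orientation (T 0).orientation →
    (∀ i < m, IsOrientedConnectedSum (T i).orientation S.orientation (T (i + 1)).orientation) →
    Nonempty ((T m).carrier ≃ₘ⟮𝓡 4, 𝓡 4⟯ 𝕊⁴) → IsCyclicShadowOfOrder (m + 2) S

/-! ### Consistency of stub 1 with the route item (definitional) -/

/-- Stub 1 is the route's support item `FiniteOrder` (stmt-8194) by name, and that item reads:
`Σ ≅ S⁴`, or a chain of oriented connected sums `T₀ = Σ # Σ`, `Tᵢ₊₁ = Tᵢ # Σ` with `T_m ≅ S⁴`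
(`Iff.rfl`). -/
example : Sig.stub_finiteOrder ↔ ∀ S : HomotopySphere 4,
    Nonempty (S.carrier ≃ₘ⟮𝓡 4, 𝓡 4⟯ 𝕊⁴) ∨ ∃ (m : ℕ) (T : ℕ → HomotopySphere 4),
      IsOrientedConnectedSum S.orientation S.orientation (T 0).orientation ∧
      (∀ i < m, IsOrientedConnectedSum (T i).orientation S.orientation (T (i + 1)).orientation) ∧
      Nonempty ((T m).carrier ≃ₘ⟮𝓡 4, 𝓡 4⟯ 𝕊⁴) :=
  Iff.rfl

/-! ## §2 The registered stubs (the ONLY `sorry`s of this file) -/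

/-- Registered stub 1 (OPEN, hardest, the crux's heart): finite order in the connected-sum monoid
— the route's support item `FiniteOrder` by name.  See `Sig.stub_finiteOrder`. -/
theorem stub_finiteOrder : Sig.stub_finiteOrder := by
  sorry

/-- Registered stub 2 (known, M–L): the round sphere is an order-2 shadow of itself, transported
along diffeomorphisms.  See `Sig.stub_roundShadow`. -/
theorem stub_roundShadow : Sig.stub_roundShadow := by
  sorry

/-- Registered stub 3 (known, L–XL): rotating the summands of `#ᵐ⁺²Σ ≅ S⁴` exhibits `Σ` as an
order-`(m+2)` shadow.  See `Sig.stub_rotateSummands`. -/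
theorem stub_rotateSummands : Sig.stub_rotateSummands := by
  sorry

/-! ## §3 The composition — the crux BY NAME from the three stubs (real proof, no `sorry`) -/

/-- **Skeleton theorem.**  Finite order, the round shadow and rotation of summands imply the crux
`Theses.QuotientSpheres.CyclicShadows` BY NAME.  Fix a homotopy 4-sphere `S`.  Stub 1 gives
`S ≅ S⁴` — then stub 2 makes `S` a shadow of order `2` — or a chain `T₀ = S # S`, `Tᵢ₊₁ = Tᵢ # S`
with `T_m ≅ S⁴` — then stub 3 makes `S` a shadow of order `m + 2 ≥ 2`.  Each hand-over is a typed
object (a diffeomorphism, resp. a chain of `IsOrientedConnectedSum` witnesses ↦ the pair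
`(g, q)` with the eight-clause predicate), not a conjunction seam. -/
theorem CyclicShadows_of :
    Sig.stub_finiteOrder → Sig.stub_roundShadow → Sig.stub_rotateSummands →
      Summit.SmoothPoincare4.SmoothPoincare4.Theses.QuotientSpheres.CyclicShadows := by
  intro hFin hRound hRot S
  -- finite order: the round case or a chain of connected sums ending at the round sphere
  rcases hFin S with hS | ⟨m, T, h0, hchain, hm⟩
  · -- `S ≅ S⁴`: the linear half-turn, transported — a shadow of order 2
    obtain ⟨g, q, hfix, hdata⟩ := hRound S hS
    exact ⟨2, g, q, le_rfl, hfix, hdata⟩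
  · -- `#ᵐ⁺² S ≅ S⁴`: rotate the summands — a shadow of order `m + 2`
    obtain ⟨g, q, hfix, hdata⟩ := hRot S m T h0 hchain hm
    exact ⟨m + 2, g, q, by omega, hfix, hdata⟩

/-- The crux by name, closed modulo the three registered stubs (its axiom closure contains
`sorryAx` through the stubs only; `CyclicShadows_of` itself is sorry-free). -/
theorem cyclicShadows_of_stubs : CyclicShadows :=
  CyclicShadows_of stub_finiteOrder stub_roundShadow stub_rotateSummands

end Summit.SmoothPoincare4.SmoothPoincare4.Cruxes.CyclicShadows.Birth

end
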